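import Summits.Langlands.Langlands.Theses.ParityBlindBianchi
import Summits.Langlands.Langlands.Theorems.ArtinWeightRealisationLevel.Negative.ZeroSector

/-!
# `ArtinWeightRealisationEven` (R″, stmt-Langlands-16619): the binder `0 ∉ S₀` removes exactly the junk zero sector

Negative-side lemmas (crux disprover `cdisprove-stmt-Langlands-16619`, cycle 1, 2026-08-17; supports
stmt-Langlands-16619; workfile `Cruxes/ArtinWeightRealisationEven/Disproof.lean` §a1, where the split
`WithoutZeroNotMem ↔ R″ ∧ ZeroSectorEven` is kernel-checked).

Hypothesis mutation "drop `(0 : ℕ) ∉ S₀`" (the rev-10 repair binder that distinguishes R″ from the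
parent crux R′ stmt-15111 on this point).  With `0 ∈ S₀` no place of `K` is good, the Hecke family is
empty and the whole `p`-adic automorphy package is PROVABLE (`hyp_of_zero_mem`, landed
`Theorems/ArtinWeightRealisationLevel/Negative/ZeroSector.lean`), while the conclusion degenerates to
`∃ hcpt π, True`.  So R″ without the binder proves the bare existence of a cuspidal automorphic
representation of `GL₂(𝔸_K)` from the data `(p, ι, ρ, K, σ)` alone
(`cuspForms_of_artinWeightRealisationEven_withoutZeroNotMem`) — a true statement (Gelbart 1975
Thm. 7.11, named fact `nonempty_cuspidalAutomorphicRepData_two`) foreign to the mechanism and not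
provable in the tree; conversely in the zero sector the mutated statement says nothing about `σ`
(`instance_of_zero_mem_of_cuspForms`, landed).  Verdict on the binder: load-bearing for TYPING only,
and the planner's repair is minimal and sufficient.  No definition, no named fact.
-/

noncomputable section

set_option linter.dupNamespace false -- `Summit.Langlands.Langlands` is the mandated namespace (D-0017)

namespace Summit.Langlands.Langlands.Theorems.ArtinWeightRealisationEven.Negative

open Summit.Langlands.Langlands.Theorems.ArtinWeightRealisationLevel.Negative (hyp_of_zero_mem)

/-- **Without `0 ∉ S₀`, R″ proves the zero sector.**  The hypothesis is the route decl
`ParityBlindBianchi.ArtinWeightRealisationEven` with the binder `(0 : ℕ) ∉ S₀` deleted (displayed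
verbatim); feed it the bad set `{0, p}` and the provable package of the zero sector
(`hyp_of_zero_mem`: `U = GL₂(𝒪̂_K)`, any unit uniformisers, the Hecke point of the EMPTY family,
vacuous association); no place is good, so its conclusion is a cuspidal `π` with no condition.
[folklore] -/
theorem cuspForms_of_artinWeightRealisationEven_withoutZeroNotMem
    (h : ∀ (p : ℕ) [Fact p.Prime] (ι : PadicAlgCl p ≃+* ℂ) (ρ : Literature.NumberTheory.GaloisRepresentations.FramedGaloisRep ℚ ℂ 2), ρ.toGaloisRep.IsIrreducible → Nonempty ((Matrix.ProjGenLinGroup.mk.comp ρ.toMonoidHom).range ≃* alternatingGroup (Fin 5)) → (∀ (φ : ℚ →+* ℝ) (c : Field.absoluteGaloisGroup ℚ), Literature.NumberTheory.GaloisRepresentations.IsComplexConjugation φ c → Matrix.GeneralLinearGroup.det (ρ c) = 1) → ∀ (K : Type) [Field K] [NumberField K], NumberField.IsTotallyComplex K → Module.finrank ℚ K = 2 → ∀ (σ : Literature.NumberTheory.GaloisRepresentations.FramedGaloisRep K (PadicAlgCl p) 2), (∀ (g : Field.absoluteGaloisGroup K) (i j : Fin 2), ι ((σ g).val i j) = ((Literature.NumberTheory.GaloisRepresentations.FramedGaloisRep.restrictField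 K ρ) g).val i j) → Finite σ.toMonoidHom.range → σ.toGaloisRep.IsIrreducible → ∀ S₀ : Finset ℕ, p ∈ S₀ → (∃ (U : Subgroup (GL (Fin 2) (IsDedekindDomain.FiniteAdeleRing (NumberField.RingOfIntegers K) K))) (ϖ : ∀ v : IsDedekindDomain.HeightOneSpectrum (NumberField.RingOfIntegers K), (v.adicCompletion K)ˣ) (a : {v : IsDedekindDomain.HeightOneSpectrum (NumberField.RingOfIntegers K) // ∀ ℓ ∈ S₀, ((ℓ : ℕ) : NumberField.RingOfIntegers K) ∉ v.asIdeal} → ℕ → (Valued.v (R := PadicAlgCl p)).valuationSubring), IsOpen (U : Set (GL (Fin 2) (IsDedekindDomain.FiniteAdeleRing (NumberField.RingOfIntegers K) K))) ∧ U ≤ Literature.NumberTheory.Automorphic.glFiniteIntegralLevel 2 K ∧ (∀ g ∈ Literature.NumberTheory.Automorphic.glFiniteIntegralLevel 2 K, (∀ v : IsDedekindDomain.HeightOneSpectrum (NumberField.RingOfIntegers K), ¬ (∀ ℓ ∈ S₀, ((ℓ : ℕ) : NumberField.RingOfIntegers K) ∉ v.asIdeal) → ∀ i j : Fin 2, ((g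 : Matrix (Fin 2) (Fin 2) (IsDedekindDomain.FiniteAdeleRing (NumberField.RingOfIntegers K) K)) i j) v = (1 : Matrix (Fin 2) (Fin 2) (v.adicCompletion K)) i j) → g ∈ U) ∧ (∀ v : IsDedekindDomain.HeightOneSpectrum (NumberField.RingOfIntegers K), Valued.v ((ϖ v : (v.adicCompletion K)ˣ) : v.adicCompletion K) = WithZero.exp (-1 : ℤ)) ∧ Literature.NumberTheory.Automorphic.IsHeckePoint (Matrix.GeneralLinearGroup.map (n := Fin 2) (algebraMap K (IsDedekindDomain.FiniteAdeleRing (NumberField.RingOfIntegers K) K))) (Literature.NumberTheory.Automorphic.LevelTower.ofSeq U (fun r : ℕ => (Literature.NumberTheory.Automorphic.principalCongruenceLevel 2 K (Ideal.span {((p : ℕ) : NumberField.RingOfIntegers K)} ^ r)).map (Literature.NumberTheory.Automorphic.GLn.sndHom 2 K))) ((p : ℕ) : (Valued.v (R := PadicAlgCl p)).valuationSubring) (fun j : {v : IsDedekindDomain.HeightOneSpectrum (NumberField.RingOfIntegers K) // ∀ ℓ ∈ S₀, ((ℓ : ℕ) : NumberField.RingOfIntegers K) ∉ v.asIdeal}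 × Fin 2 => Literature.NumberTheory.Automorphic.GLn.sndHom 2 K (Literature.NumberTheory.Automorphic.heckeDiagAt 2 K j.1.1 (ϖ j.1.1) (j.2.val + 1))) (fun j => a j.1 (j.2.val + 1)) ∧ ∀ (v : IsDedekindDomain.HeightOneSpectrum (NumberField.RingOfIntegers K)) (hv : ∀ ℓ ∈ S₀, ((ℓ : ℕ) : NumberField.RingOfIntegers K) ∉ v.asIdeal), σ.IsHeckeAssociatedAt v (fun i : ℕ => if i = 0 then (1 : PadicAlgCl p) else ((a ⟨v, hv⟩ i : (Valued.v (R := PadicAlgCl p)).valuationSubring) : PadicAlgCl p))) → ∃ (hcpt : Literature.NumberTheory.Automorphic.isCompact_glFiniteIntegralLevel 2 K) (π : Literature.NumberTheory.Automorphic.CuspidalAutomorphicRepData 2 K hcpt), ∀ w : IsDedekindDomain.HeightOneSpectrum (NumberField.RingOfIntegers K), (∀ ℓ ∈ S₀, ((ℓ : ℕ) : NumberField.RingOfIntegers K) ∉ w.asIdeal) → SatakeFrobCompatibleAt ι π.1 σ w) :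
    ∀ (p : ℕ) [Fact p.Prime] (ι : PadicAlgCl p ≃+* ℂ) (ρ : Literature.NumberTheory.GaloisRepresentations.FramedGaloisRep ℚ ℂ 2), ρ.toGaloisRep.IsIrreducible → Nonempty ((Matrix.ProjGenLinGroup.mk.comp ρ.toMonoidHom).range ≃* alternatingGroup (Fin 5)) → (∀ (φ : ℚ →+* ℝ) (c : Field.absoluteGaloisGroup ℚ), Literature.NumberTheory.GaloisRepresentations.IsComplexConjugation φ c → Matrix.GeneralLinearGroup.det (ρ c) = 1) → ∀ (K : Type) [Field K] [NumberField K], NumberField.IsTotallyComplex K → Module.finrank ℚ K = 2 → ∀ (σ : Literature.NumberTheory.GaloisRepresentations.FramedGaloisRep K (PadicAlgCl p) 2), (∀ (g : Field.absoluteGaloisGroup K) (i j : Fin 2), ι ((σ g).val i j) = ((Literature.NumberTheory.GaloisRepresentations.FramedGaloisRep.restrictField K ρ) g).val i j) → Finite σ.toMonoidHom.range → σ.toGaloisRep.IsIrreducible → ∃ hcpt : Literature.NumberTheory.Automorphic.isCompact_glFiniteIntegralLevel 2 K, Nonempty (Literature.NumberTheory.Automorphic.CuspidalAutomorphicRepData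 2 K hcpt) := by
  intro p _ ι ρ hirr hA5 heven K _ _ htc hdeg σ hmodel hfin hirrσ
  obtain ⟨hcpt, π, -⟩ := h p ι ρ hirr hA5 heven K htc hdeg σ hmodel hfin hirrσ {0, p} (by simp)
    (hyp_of_zero_mem K p σ {0, p} (by simp))
  exact ⟨hcpt, ⟨π⟩⟩

end Summit.Langlands.Langlands.Theorems.ArtinWeightRealisationEven.Negative

end
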